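import Summits.Ventures.QEC.Census.TwoBGA.TB_l6m24_A0_0_0_1_3_11_B0_0_1_11_5_4.Q144.WitA
import Summits.Ventures.QEC.Census.BB.A1s_n192_k4_0fa3ae82.Wit
import HarnessLib

set_option Elab.async false
set_option maxRecDepth 200000

/-!
# `quotient-[[144,12,d_Z≥8]]` one-level cover certificate of `TB_l6m24_A0_0_0_1_3_11_B0_0_1_11_5_4.Q144` — WITNESS TABLE of the level-1 list: the kernel-generated orbit table `orbTab eTr eInv 36 eReps`
# is a valid witness table (`witnessOK`) — qec-type-10's round-trip check `orbCheck` assembled from the 1 chunk verdicts of `WitA`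
(`orbCheckAux_append` imported from the [[192,4,18]] chain's `Wit` p545098) and `CertCoverBatch.witnessOK_of_orbCheck`; the 36 downstairs tables `ePermqs` are permutation tables
(`permListOK`). qec-search-1 g5 (pattern of search-9 g5 `Wit` p545098). Theorems only; KERNEL.
-/

namespace Summit.Ventures.QEC.Census.TB_l6m24_A0_0_0_1_3_11_B0_0_1_11_5_4.Q144

open Matrix Summit.Ventures.QEC.Census Literature.InformationTheory.QuantumCodes

/-- The chunk is `eReps`. -/
theorem repsC_eq : TB_l6m24_A0_0_0_1_3_11_B0_0_1_11_5_4.Q144.repsC0 = eReps := by decide +kernel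

/-- **The round trip of the whole orbit table.** -/
theorem eOrb_check : orbCheck TB_l6m24_A0_0_0_1_3_11_B0_0_1_11_5_4.Q144.ePermqs eTr eInv 36 eReps = true := by
  rw [← repsC_eq]; exact orbChk0

set_option maxHeartbeats 400000000 in
/-- The 36 downstairs tables are permutation tables of the 72 qubits. -/
theorem ePermqs_ok : ∀ i : ℕ, i < TB_l6m24_A0_0_0_1_3_11_B0_0_1_11_5_4.Q144.ePermqs.length → permListOK 72 (ePermqs.getD i []) = true := by
  have h : ((List.range 36).all fun i => permListOK 72 (ePermqs.getD i [])) = true := by decide +kernel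
  have hl : ePermqs.length = 36 := by decide
  intro i hi
  rw [hl] at hi
  simp only [List.all_eq_true, List.mem_range] at h
  exact h i hi

/-- ★ **`wit_ok`**: the generated orbit table is a valid witness table for `eReps` over `ePermqs`. -/
theorem wit_ok : witnessOK 72 TB_l6m24_A0_0_0_1_3_11_B0_0_1_11_5_4.Q144.ePermqs eReps (orbTab eTr eInv 36 eReps) = true := witnessOK_of_orbCheck ePermqs_ok eOrb_check

/-- `hcw`: the orbit word list is covered by its own table. -/
theorem hcw : coveredOK TB_l6m24_A0_0_0_1_3_11_B0_0_1_11_5_4.Q144.eOrb (orbTab eTr eInv 36 eReps) = true := coveredOK_orbWords eReps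

end Summit.Ventures.QEC.Census.TB_l6m24_A0_0_0_1_3_11_B0_0_1_11_5_4.Q144
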